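import Literature.MathematicalPhysics.QuantumFieldTheory.Balaban1983to89.Beta.CombesThomasFormOp

/-!
# `Balaban1983to89.B6Cov2110CombesThomas` — T. Bałaban, *Propagators and renormalization transformations for lattice gauge
# theories. II*, Commun. Math. Phys. **96** (1984) 223–250 [Balaban1984PropagatorsII], p. 242 (text after (2.110)): *«From the theorem
# on unit lattice operators in [3] it follows that a covariance C^{(j)}_Λ of the last Gaussian integrals in (2.106) is a bounded operator
# with an exponential decay independent of j and Λ»* — THE ABSTRACT STEP of the Combes–Thomas route to this decay FOR A COVARIANCE ON A
# CONSTRAINT SUBSPACE: the inverse of a form `S` COMPRESSED to the range of a block-local projection `P` decays exponentially as soon as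
# `S ≥ γ` on `range P` and the conjugation error of `S` under block-constant exponential weights is `≥ −(γ/2)‖·‖²`

statement-level skeleton of published theorems with citation tags; proofs where landed; nothing here is a claim about the Yang–Mills mass gap

PDF held: `paper:balaban1984-cmp96-propagators-rt-ii` (journal page = PDF page + 222; p. 242 [PDF 20] read AS IMAGE on the ×2 render
`run/shared/lean/pub/pub-balaban/b2b-balaban-ref1/pages/1984-cmp96-propagators-rt-II/…-p020-x2.png`, 2026-08-21).  The same sentence
pattern recurs on p. 246 (*«C̃^{(j)}_Λ … has an exponential decay»*) and p. 248 (*«an exponential decay of a kernel of the operator in (2.147)»*);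
«[3]» = [Balaban1983RegularityDecay] (Theorem p. 573, Sect. 5 pp. 594–596: inverses of strictly positive, exponentially decaying unit-lattice
operators decay exponentially).

CITATION HEADER (lean-in-tree rule) — WHAT IS REPRODUCED.  Phase-2 file of the `lit-balaban` typed skeleton (HOME
`run/shared/lean/pub/lit-balaban/`), seat **p22 gen 11** (B6 fold owner r03, referee ref-4; lane = the Sect. C chain (2.95)–(2.147) on the
concrete two-scale data `tsV1`).  SKELETON rows **B6.Eq2.110** (*"(2.110) + C^{(j)}_Λ"*) / **B6.Txt@246** / **B6.Eq2.144** — the «exponential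
decay» clauses, NOT YET INSTANCED for the concrete model (cf. the same seat's `…B6Cov2110TwoScaleV1`: boundedness only).  THIS FILE is
ELEMENTARY FINITE-DIMENSIONAL LINEAR ALGEBRA in the style of pv23's `Beta/CombesThomasForm(Op)` (IMPORTED BY NAME: `combesThomas_form`'s operator
form `setDecay_form_op`), kernel-checked from Mathlib; it is the abstract step that the three covariances of Sect. C share (`C^{(j)}_Λ =
(Δ′_j↾S₁)⁻¹`, `C̃^{(j)}_Λ = ((Q″*aQ″ + Δ_j)↾Ax)⁻¹`, `C_□`): each is the inverse of a form COMPRESSED TO A CONSTRAINT SUBSPACE whose orthogonal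
projection `P` is block-local (admissible `ω`: zero off `B(Λ′)`, zero block means on `Λ′`; axial `B`: tree gauge per block).  For real matrices
`P` (symmetric idempotent), `S`, a constant `γ` and a weight `φ` CONSTANT ON THE BLOCKS OF `P` (`P_{jk} ≠ 0 ⇒ φ_j = φ_k`):
* §1 the compressed operator `H = PSP + γ(1 − P)`: `biform_compressed` (`⟨u, Hv⟩ = ⟨Pu, SPv⟩ + γ(⟨u, v⟩ − ⟨Pu, Pv⟩)`), **`coercive_compressed`**
  (`S ≥ γ` on `range P` ⇒ `H ≥ γ` everywhere);
* §2 **`conjError_compressed`**: the Combes–Thomas conjugation error of `H` at `w` EQUALS that of `S` at `Pw` (block-constant weights commute with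
  `P`, `mulVec_weight`; the `γ(1 − P)` part has none), hence **`herr_compressed`**;
* §3 **`cov_sq_le`**: every solution `c` of `Hc = Pe_{i′}` — i.e. the `i′`-column of the covariance `C = ι(ι*Sι)⁻¹ι*` on `range P` (`Pc = c`,
  `PSc = Pe_{i′}`, `covariance_solves`) — satisfies `c_i² ≤ (2/γ)²·e^{−2(φ_i − φ_{i′})}·P_{i′i′}`, and **`cov_abs_le`**: `|c_i| ≤ (2/γ)e^{−(φ_i − φ_{i′})}`
  (`proj_diag_le_one`), by `Beta.CombesThomasFormOp.setDecay_form_op` BY NAME applied to `H`.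
THEOREMS ONLY (no definition, no `def … : Prop` fact); standard axioms.  HONEST SCOPE: abstract step only — the INSTANCE for `tsV1` (matrix of
`Δ′_j` in the site basis = `θ·Re dPOp` by the same seat's `…B6DeltaPrimeKernelTwoScaleV1.inner_single_Dp_single`; kernel of the projection onto
the admissible `ω`; a block-constant torus-distance weight `φ` with the row-sum (Schur) bound giving the error hypothesis from r03's
`…B6DeltaPrimeKernelTorus.norm_dPOp_le`) is NOT in this file (successor plan `lit-balaban-p22/GEN12-PLAN.md` item 1; LANDED since as
`…B6Cov2110MatrixV1` / `…B6Cov2110WeightV1` / `…B6Cov2110DecayV1`); the route is the exponential-conjugation method (of Combes–Thomas type — OUR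
label: neither paper names it) that the papers DESCRIBE without attribution ([Balaban1984PropagatorsI] p. 36 [PDF 20, text layer L22–25] «Probably the
simplest proof of the exponential decay properties can be obtained by … proving that the operator e^{−⟨q,x⟩}Δ_a e^{⟨q,x⟩} − Δ_a is a small perturbation
of Δ_a for vectors q ∈ R^d sufficiently small. Instead we construct a random walk representation …»; [Balaban1984PropagatorsII] p. 237 [PDF 15, L6–9]
«Another way to prove it is to consider the operator e^{⟨a,·⟩}(…)e^{−⟨a,·⟩}, and to prove that it is almost equal to the operator without the exponential
functions, the difference being of the order O(|a|), for a small vector a ∈ R^d») rather than [3]'s random walk; real symmetric matrices on a finite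
index set; NOT summit progress.  (v1.1, 2026-08-22: this attribution sentence corrected at referee ref-1 g48's note, quotes re-read on the `lit read`
text layers; declarations byte-identical to v1 p309841.)
-/

noncomputable section

open Finset Matrix

namespace Literature.MathematicalPhysics.QuantumFieldTheory.Balaban1983to89.B6Cov2110CombesThomas

open Beta.CombesThomasFormOp (setDecay_form_op)

variable {n : Type*} [Fintype n]

/-! ## §1  The compressed operator `H = PSP + γ(1 − P)` and its coercivity -/

section Compressed

variable (Pm S : Matrix n n ℝ) (γ : ℝ)

/-- `⟨u, Pv⟩ = ⟨Pu, v⟩` for symmetric `P`. [cite: Balaban1984PropagatorsII, p.242 (text after (2.110))] -/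
theorem dotProduct_proj_mulVec (hPs : Pm.IsSymm) (u v : n → ℝ) : u ⬝ᵥ Pm *ᵥ v = Pm *ᵥ u ⬝ᵥ v := by
  rw [Matrix.dotProduct_mulVec, ← Matrix.vecMul_transpose, hPs.eq]

/-- `⟨Pu, Pv⟩ = ⟨u, Pv⟩` for a symmetric idempotent `P`. [cite: Balaban1984PropagatorsII, p.242 (text after (2.110))] -/
theorem proj_dotProduct_proj (hPs : Pm.IsSymm) (hPi : Pm * Pm = Pm) (u v : n → ℝ) :
    Pm *ᵥ u ⬝ᵥ Pm *ᵥ v = u ⬝ᵥ Pm *ᵥ v := by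
  rw [← dotProduct_proj_mulVec Pm hPs u (Pm *ᵥ v), Matrix.mulVec_mulVec, hPi]

/-- Pythagoras: `‖w‖² = ‖Pw‖² + ‖w − Pw‖²`. [cite: Balaban1984PropagatorsII, p.242 (text after (2.110))] -/
theorem norm_sq_split (hPs : Pm.IsSymm) (hPi : Pm * Pm = Pm) (w : n → ℝ) :
    w ⬝ᵥ w = Pm *ᵥ w ⬝ᵥ Pm *ᵥ w + (w - Pm *ᵥ w) ⬝ᵥ (w - Pm *ᵥ w) := by
  have h1 : Pm *ᵥ w ⬝ᵥ Pm *ᵥ w = w ⬝ᵥ Pm *ᵥ w := proj_dotProduct_proj Pm hPs hPi w w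
  have h2 : Pm *ᵥ w ⬝ᵥ w = w ⬝ᵥ Pm *ᵥ w := dotProduct_comm _ _
  rw [sub_dotProduct, dotProduct_sub, dotProduct_sub, h1, h2]
  ring

/-- `‖Pw‖² ≤ ‖w‖²`. [cite: Balaban1984PropagatorsII, p.242 (text after (2.110))] -/
theorem proj_norm_sq_le (hPs : Pm.IsSymm) (hPi : Pm * Pm = Pm) (w : n → ℝ) : Pm *ᵥ w ⬝ᵥ Pm *ᵥ w ≤ w ⬝ᵥ w := by
  have h := norm_sq_split Pm hPs hPi w
  have h0 : 0 ≤ (w - Pm *ᵥ w) ⬝ᵥ (w - Pm *ᵥ w) := by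
    simp only [dotProduct]
    exact Finset.sum_nonneg fun i _ => mul_self_nonneg _
  linarith

variable [DecidableEq n]

/-- the form of the compressed operator: `⟨u, (PSP + γ(1 − P))v⟩ = ⟨Pu, S(Pv)⟩ + γ(⟨u, v⟩ − ⟨Pu, Pv⟩)`.
[cite: Balaban1984PropagatorsII, p.242 (text after (2.110))] -/
theorem biform_compressed (hPs : Pm.IsSymm) (hPi : Pm * Pm = Pm) (u v : n → ℝ) :
    u ⬝ᵥ (Pm * S * Pm + γ • (1 - Pm)) *ᵥ v = Pm *ᵥ u ⬝ᵥ S *ᵥ (Pm *ᵥ v) + γ * (u ⬝ᵥ v - Pm *ᵥ u ⬝ᵥ Pm *ᵥ v) := by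
  rw [Matrix.add_mulVec, Matrix.smul_mulVec, Matrix.sub_mulVec, Matrix.one_mulVec, ← Matrix.mulVec_mulVec, ← Matrix.mulVec_mulVec,
    dotProduct_add, dotProduct_smul, dotProduct_sub, smul_eq_mul, dotProduct_proj_mulVec Pm hPs u (S *ᵥ (Pm *ᵥ v)),
    ← proj_dotProduct_proj Pm hPs hPi u v]

/-- **the compressed operator is coercive**: `S ≥ γ` on `range P` ⇒ `PSP + γ(1 − P) ≥ γ` on the whole space.
[cite: Balaban1984PropagatorsII, p.242 (text after (2.110))] -/
theorem coercive_compressed (hPs : Pm.IsSymm) (hPi : Pm * Pm = Pm)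
    (hS : ∀ u : n → ℝ, γ * (Pm *ᵥ u ⬝ᵥ Pm *ᵥ u) ≤ Pm *ᵥ u ⬝ᵥ S *ᵥ (Pm *ᵥ u)) (ω : n → ℝ) :
    γ * (ω ⬝ᵥ ω) ≤ ω ⬝ᵥ (Pm * S * Pm + γ • (1 - Pm)) *ᵥ ω := by
  rw [biform_compressed Pm S γ hPs hPi]
  have h1 := hS ω
  have h2 := norm_sq_split Pm hPs hPi ω
  have h0 : 0 ≤ (ω - Pm *ᵥ ω) ⬝ᵥ (ω - Pm *ᵥ ω) := by
    simp only [dotProduct]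
    exact Finset.sum_nonneg fun i _ => mul_self_nonneg _
  nlinarith

/-- a solution `c` of `(PSP + γ(1 − P))c = Pv` (`γ ≠ 0`) lies in `range P` and solves the compressed equation `PSc = Pv` — it IS the value at
`v` of the covariance `ι(ι*Sι)⁻¹ι*` of `S` on `range P`. [cite: Balaban1984PropagatorsII, p.242 (text after (2.110))] -/
theorem covariance_solves (hPi : Pm * Pm = Pm) (hγ : γ ≠ 0) (v c : n → ℝ)
    (hc : (Pm * S * Pm + γ • (1 - Pm)) *ᵥ c = Pm *ᵥ v) :
    Pm *ᵥ c = c ∧ Pm *ᵥ (S *ᵥ c) = Pm *ᵥ v := by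
  have h1 : Pm *ᵥ ((Pm * S * Pm + γ • (1 - Pm)) *ᵥ c) = Pm *ᵥ (Pm *ᵥ v) := by rw [hc]
  rw [Matrix.mulVec_mulVec, Matrix.mulVec_mulVec, hPi, Matrix.mul_add, Matrix.mul_smul, Matrix.mul_sub, Matrix.mul_one, hPi, sub_self,
    smul_zero, add_zero, ← Matrix.mul_assoc, ← Matrix.mul_assoc, hPi] at h1
  -- `h1 : (P S P) c = P v`; subtract from `hc`: `γ(c − Pc) = 0`
  have h2 : γ • (c - Pm *ᵥ c) = 0 := by
    have h3 := hc
    rw [Matrix.add_mulVec, Matrix.smul_mulVec, Matrix.sub_mulVec, Matrix.one_mulVec, h1] at h3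
    exact add_eq_left.mp h3
  have hPc : Pm *ᵥ c = c := by
    have h5 := (smul_eq_zero.mp h2).resolve_left hγ
    exact (sub_eq_zero.mp h5).symm
  refine ⟨hPc, ?_⟩
  have h6 : (Pm * S * Pm) *ᵥ c = Pm *ᵥ (S *ᵥ c) := by
    rw [← Matrix.mulVec_mulVec, ← Matrix.mulVec_mulVec, hPc]
  rw [← h6, h1]

end Compressed

/-! ## §2  Block-constant weights: the conjugation error of the compressed operator is that of `S` on `range P` -/

section Weights

variable (Pm S : Matrix n n ℝ) (γ : ℝ) (φ : n → ℝ)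

/-- a weight constant on the blocks of `P` commutes with `P`: `P(e·w) = e·(Pw)`. [cite: Balaban1984PropagatorsII, p.242 (text after (2.110))] -/
theorem mulVec_weight (e : n → ℝ) (he : ∀ j k, Pm j k ≠ 0 → e j = e k) (w : n → ℝ) :
    Pm *ᵥ (fun k => e k * w k) = fun j => e j * (Pm *ᵥ w) j := by
  funext j
  simp only [Matrix.mulVec, dotProduct, Finset.mul_sum]
  refine Finset.sum_congr rfl fun k _ => ?_
  by_cases h : Pm j k = 0
  · rw [h]; ring
  · rw [he j k h]; ring

/-- the Combes–Thomas conjugation error as a difference of two forms: `Σ_{jk}(e^{φ_j−φ_k} − 1)M_{jk}w_jw_k = ⟨e^{φ}w, M(e^{−φ}w)⟩ − ⟨w, Mw⟩`.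
[cite: CombesThomas1973, §II] -/
theorem conjSum_eq (M : Matrix n n ℝ) (w : n → ℝ) :
    ∑ j, ∑ k, (Real.exp (φ j - φ k) - 1) * M j k * (w j * w k) =
      (fun j => Real.exp (φ j) * w j) ⬝ᵥ M *ᵥ (fun k => Real.exp (-φ k) * w k) - w ⬝ᵥ M *ᵥ w := by
  have h1 : ∀ j k, (Real.exp (φ j - φ k) - 1) * M j k * (w j * w k) =
      Real.exp (φ j) * w j * (M j k * (Real.exp (-φ k) * w k)) - w j * (M j k * w k) := by
    intro j k
    rw [Real.exp_sub, Real.exp_neg]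
    ring
  simp only [h1, Finset.sum_sub_distrib, dotProduct, Matrix.mulVec, Finset.mul_sum]

/-- `⟨e^{φ}u, e^{−φ}v⟩ = ⟨u, v⟩`. [cite: CombesThomas1973, §II] -/
theorem weight_dotProduct_weight (u v : n → ℝ) :
    (fun j => Real.exp (φ j) * u j) ⬝ᵥ (fun k => Real.exp (-φ k) * v k) = u ⬝ᵥ v := by
  simp only [dotProduct]
  refine Finset.sum_congr rfl fun j _ => ?_
  have h : Real.exp (φ j) * Real.exp (-φ j) = 1 := by rw [← Real.exp_add, add_neg_cancel, Real.exp_zero]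
  linear_combination (u j * v j) * h

variable [DecidableEq n]

/-- **the conjugation error of the compressed operator at `w` IS that of `S` at `Pw`** (weights constant on the blocks of `P`).
[cite: Balaban1984PropagatorsII, p.242 (text after (2.110))] -/
theorem conjError_compressed (hPs : Pm.IsSymm) (hPi : Pm * Pm = Pm) (hφ : ∀ j k, Pm j k ≠ 0 → φ j = φ k) (w : n → ℝ) :
    ∑ j, ∑ k, (Real.exp (φ j - φ k) - 1) * (Pm * S * Pm + γ • (1 - Pm)) j k * (w j * w k) =
      ∑ j, ∑ k, (Real.exp (φ j - φ k) - 1) * S j k * ((Pm *ᵥ w) j * (Pm *ᵥ w) k) := by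
  have heφ : ∀ j k, Pm j k ≠ 0 → Real.exp (φ j) = Real.exp (φ k) := fun j k h => by rw [hφ j k h]
  have heφ' : ∀ j k, Pm j k ≠ 0 → Real.exp (-φ j) = Real.exp (-φ k) := fun j k h => by rw [hφ j k h]
  rw [conjSum_eq, conjSum_eq, biform_compressed Pm S γ hPs hPi, biform_compressed Pm S γ hPs hPi,
    mulVec_weight Pm (fun k => Real.exp (φ k)) heφ w, mulVec_weight Pm (fun k => Real.exp (-φ k)) heφ' w,
    weight_dotProduct_weight, weight_dotProduct_weight, proj_dotProduct_proj Pm hPs hPi w w]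
  ring

/-- **hence the error hypothesis of Combes–Thomas passes from `S` on `range P` to the compressed operator**: if
`Σ(e^{φ_j−φ_k} − 1)S_{jk}(Pu)_j(Pu)_k ≥ −(σ/2)‖Pu‖²` for all `u` (`σ ≥ 0`), then the error of `PSP + γ(1 − P)` is `≥ −(σ/2)‖w‖²`.
[cite: Balaban1984PropagatorsII, p.242 (text after (2.110))] -/
theorem herr_compressed (hPs : Pm.IsSymm) (hPi : Pm * Pm = Pm) (hφ : ∀ j k, Pm j k ≠ 0 → φ j = φ k) {σ : ℝ} (hσ : 0 ≤ σ)
    (hSe : ∀ u : n → ℝ, -(σ / 2) * (Pm *ᵥ u ⬝ᵥ Pm *ᵥ u) ≤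
      ∑ j, ∑ k, (Real.exp (φ j - φ k) - 1) * S j k * ((Pm *ᵥ u) j * (Pm *ᵥ u) k)) (w : n → ℝ) :
    -(σ / 2) * (w ⬝ᵥ w) ≤ ∑ j, ∑ k, (Real.exp (φ j - φ k) - 1) * (Pm * S * Pm + γ • (1 - Pm)) j k * (w j * w k) := by
  rw [conjError_compressed Pm S γ φ hPs hPi hφ]
  have h1 := hSe w
  have h2 : σ / 2 * (Pm *ᵥ w ⬝ᵥ Pm *ᵥ w) ≤ σ / 2 * (w ⬝ᵥ w) :=
    mul_le_mul_of_nonneg_left (proj_norm_sq_le Pm hPs hPi w) (by positivity)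
  linarith

end Weights

/-! ## §3  Exponential decay of the covariance on `range P` -/

section Decay

variable (Pm S : Matrix n n ℝ) (γ : ℝ) (φ : n → ℝ)

/-- the diagonal of a symmetric idempotent: `P_{ii} = Σ_j P_{ji}²`. [cite: Balaban1984PropagatorsII, p.242 (text after (2.110))] -/
theorem proj_diag_eq (hPs : Pm.IsSymm) (hPi : Pm * Pm = Pm) (i : n) : Pm i i = ∑ j, Pm j i ^ 2 := by
  have h := congrFun (congrFun hPi i) i
  rw [Matrix.mul_apply] at h
  rw [← h]
  refine Finset.sum_congr rfl fun j _ => ?_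
  rw [sq, hPs.apply i j]

/-- `0 ≤ P_{ii} ≤ 1`. [cite: Balaban1984PropagatorsII, p.242 (text after (2.110))] -/
theorem proj_diag_le_one (hPs : Pm.IsSymm) (hPi : Pm * Pm = Pm) (i : n) : 0 ≤ Pm i i ∧ Pm i i ≤ 1 := by
  have h := proj_diag_eq Pm hPs hPi i
  have h0 : 0 ≤ ∑ j, Pm j i ^ 2 := Finset.sum_nonneg fun j _ => sq_nonneg _
  have h1 : Pm i i ^ 2 ≤ ∑ j, Pm j i ^ 2 :=
    Finset.single_le_sum (f := fun j => Pm j i ^ 2) (fun j _ => sq_nonneg _) (Finset.mem_univ i)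
  rw [← h] at h0 h1
  exact ⟨h0, by nlinarith⟩

variable [DecidableEq n]

/-- **EXPONENTIAL DECAY OF THE COVARIANCE ON A CONSTRAINT SUBSPACE** (squared form): `P` symmetric idempotent, `φ` constant on the blocks of
`P`, `S ≥ γ > 0` on `range P`, conjugation error of `S` on `range P` `≥ −(γ/2)‖·‖²`; then every solution `c` of `(PSP + γ(1 − P))c = Pe_{i′}` —
the `i′`-column of the covariance (`covariance_solves`) — satisfies `c_i² ≤ (2/γ)²e^{−2(φ_i − φ_{i′})}P_{i′i′}` (pv23's `setDecay_form_op`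
BY NAME for the compressed operator, source set `{k : P_{ki′} ≠ 0}` on which `φ ≡ φ_{i′}`). [cite: Balaban1984PropagatorsII, p.242 (text after (2.110))] -/
theorem cov_sq_le (hPs : Pm.IsSymm) (hPi : Pm * Pm = Pm) (hφ : ∀ j k, Pm j k ≠ 0 → φ j = φ k) (hγ : 0 < γ)
    (hS : ∀ u : n → ℝ, γ * (Pm *ᵥ u ⬝ᵥ Pm *ᵥ u) ≤ Pm *ᵥ u ⬝ᵥ S *ᵥ (Pm *ᵥ u))
    (hSe : ∀ u : n → ℝ, -(γ / 2) * (Pm *ᵥ u ⬝ᵥ Pm *ᵥ u) ≤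
      ∑ j, ∑ k, (Real.exp (φ j - φ k) - 1) * S j k * ((Pm *ᵥ u) j * (Pm *ᵥ u) k))
    (i i' : n) (c : n → ℝ) (hc : (Pm * S * Pm + γ • (1 - Pm)) *ᵥ c = Pm *ᵥ Pi.single i' 1) :
    c i ^ 2 ≤ (2 / γ) ^ 2 * Real.exp (-(2 * (φ i - φ i'))) * Pm i' i' := by
  have hg : ∀ k, k ∉ Finset.univ.filter (fun k => Pm k i' ≠ 0) → (Pm *ᵥ Pi.single i' (1 : ℝ)) k = 0 := by
    intro k hk
    rw [Matrix.mulVec_single_one, Matrix.col_apply]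
    by_contra h
    exact hk (Finset.mem_filter.mpr ⟨Finset.mem_univ _, h⟩)
  have h := setDecay_form_op (Pm * S * Pm + γ • (1 - Pm)) γ φ hγ (coercive_compressed Pm S γ hPs hPi hS)
    (herr_compressed Pm S γ φ hPs hPi hφ hγ.le hSe) {i} (Finset.univ.filter (fun k => Pm k i' ≠ 0)) (φ i) (φ i')
    (fun k hk => by rw [Finset.mem_singleton.mp hk]) (fun k hk => (hφ k i' (Finset.mem_filter.mp hk).2).le)
    (Pm *ᵥ Pi.single i' 1) c hg hc
  rw [Finset.sum_singleton] at h
  have hsum : ∑ j, (Pm *ᵥ Pi.single i' (1 : ℝ)) j ^ 2 = Pm i' i' := by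
    rw [proj_diag_eq Pm hPs hPi i', Matrix.mulVec_single_one]
    rfl
  rw [hsum] at h
  exact h

/-- … hence **`|c_i| ≤ (2/γ)·e^{−(φ_i − φ_{i′})}`** (`P_{i′i′} ≤ 1`): the kernel of the covariance on `range P` decays at the rate of the weight.
[cite: Balaban1984PropagatorsII, p.242 (text after (2.110))] -/
theorem cov_abs_le (hPs : Pm.IsSymm) (hPi : Pm * Pm = Pm) (hφ : ∀ j k, Pm j k ≠ 0 → φ j = φ k) (hγ : 0 < γ)
    (hS : ∀ u : n → ℝ, γ * (Pm *ᵥ u ⬝ᵥ Pm *ᵥ u) ≤ Pm *ᵥ u ⬝ᵥ S *ᵥ (Pm *ᵥ u))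
    (hSe : ∀ u : n → ℝ, -(γ / 2) * (Pm *ᵥ u ⬝ᵥ Pm *ᵥ u) ≤
      ∑ j, ∑ k, (Real.exp (φ j - φ k) - 1) * S j k * ((Pm *ᵥ u) j * (Pm *ᵥ u) k))
    (i i' : n) (c : n → ℝ) (hc : (Pm * S * Pm + γ • (1 - Pm)) *ᵥ c = Pm *ᵥ Pi.single i' 1) :
    |c i| ≤ 2 / γ * Real.exp (-(φ i - φ i')) := by
  have h := cov_sq_le Pm S γ φ hPs hPi hφ hγ hS hSe i i' c hc
  have hd := proj_diag_le_one Pm hPs hPi i'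
  have hexp : Real.exp (-(2 * (φ i - φ i'))) = Real.exp (-(φ i - φ i')) ^ 2 := by
    rw [sq, ← Real.exp_add]
    congr 1
    ring
  refine abs_le_of_sq_le_sq ?_ (by positivity)
  calc c i ^ 2 ≤ (2 / γ) ^ 2 * Real.exp (-(2 * (φ i - φ i'))) * Pm i' i' := h
    _ ≤ (2 / γ) ^ 2 * Real.exp (-(2 * (φ i - φ i'))) * 1 := mul_le_mul_of_nonneg_left hd.2 (by positivity)
    _ = (2 / γ * Real.exp (-(φ i - φ i'))) ^ 2 := by rw [hexp]; ring

end Decay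

end Literature.MathematicalPhysics.QuantumFieldTheory.Balaban1983to89.B6Cov2110CombesThomas

end
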